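import Summits.HodgeConjecture.HodgeCM.PerL34.EulerProduct_1

/-! PORT of `HodgeCM/PerL34/EulerProduct.lean` (HodgeCMPerL run 82) — part 2: continuation of `Summits.HodgeConjecture.HodgeCM.PerL34.EulerProduct_1` (split at a top-level declaration boundary by port_pkg.py; scope re-opened below; declarations unchanged). -/

-- port_pkg: scope re-opened for this part (file-level context, then the namespace/section stack open at the cut)
set_option autoImplicit false
noncomputable section
namespace HodgeCM
namespace PerL34
namespace EulerProduct
open HodgeCM.Prior.Perl34File
open HodgeCM.Prior.Perl34File.Perl34.C4
open scoped InnerProductSpace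
variable {V : Type}
/-- **Local-factor datum** for ONE candidate `(W_i, μ_i, χ'_i)` and ONE factorizable Fock–Schwartz vector
`φ = ⊗ φ_v` (PerL v5 ll. 608–631).  `V` indexes the places of `L₀`.  Every `Prop` field is the OUTPUT of an
upstream node of LEMMAS.md (named in the field docstring) or a definitional property of the intended objects;
compared with `Perl34.C4.RallisDatum` the fields `tail`, `AX7_tail`, `tpar_nonneg`, `tpar_le`, `apar_norm` are
gone (theorems below). -/
structure LocalFactorDatum (V : Type) (E : Type*) [NormedAddCommGroup E] [InnerProductSpace ℂ E] where
  /-- the local factors `I_v(φ_v) = ∫_{U(W_i)(L_{0,v})} ⟨ω_v(y)φ_v, φ_v⟩ χ'_v(y) dy` (l. 609), real (l. 612) -/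
  I : V → ℝ
  /-- the finite exceptional set of l. 623–628 (archimedean places, ramified data) -/
  S : Finset V
  /-- residue field size `q_v` (used at `v ∉ S`) -/
  q : V → ℕ
  /-- `χ'_v(ϖ_v)` and `ν_v(ϖ_v)` (l. 630), used at split `v ∉ S` -/
  chiPi : V → ℂ
  nuPi : V → ℂ
  /-- "`v` splits in `L`" -/
  IsSplit : V → Prop
  /-- Weil's Siegel–Weil constant `c > 0` (l. 580–581; N31d) and `vol([U(W_i)]) > 0` (l. 597; N31e) -/
  c : ℝ
  vol : ℝ
  c_pos : 0 < c
  vol_pos : 0 < vol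
  /-- the theta lift `θ_φ(χ')` in `L²([G_U])` and the set of all lifts `θ(φ', χ')` spanning `π_i` -/
  theta : E
  Theta : Set E
  theta_mem : theta ∈ Theta
  /-- a residue field has at least two elements -/
  two_le_q : ∀ v, v ∉ S → 2 ≤ q v
  /-- `χ'`, `ν` unitary: values of absolute value `1` (l. 630–631) -/
  chi_norm : ∀ v, v ∉ S → ‖chiPi v‖ = 1
  nu_norm : ∀ v, v ∉ S → ‖nuPi v‖ = 1
  /-- OUTPUT of N31f (ll. 612–623): `I_v(φ_v) > 0` at the finitely many `v ∈ S` -/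
  ram_pos : ∀ v ∈ S, 0 < I v
  /-- OUTPUT of N31g (ll. 629–631): split unramified value `I_v(φ⁰_v) = Σ_{n∈ℤ} q_v^{−3|n|/2} a_vⁿ`,
  `a_v = χ'_v(ϖ_v) ν_v(ϖ_v)` -/
  split_val : ∀ v, v ∉ S → IsSplit v →
    (I v : ℂ) = ∑' n : ℤ, ((tOf (q v) : ℝ) : ℂ) ^ n.natAbs * (chiPi v * nuPi v) ^ n
  /-- OUTPUT of N31g (ll. 626–629): non-split unramified value `I_v(φ⁰_v) = 1` -/
  nonsplit_val : ∀ v, v ∉ S → ¬IsSplit v → I v = 1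
  /-- `Σ_{v∉S} q_v^{−3/2} < ∞` (Dedekind zeta comparison; PROVABLE, see module docstring) -/
  summable_t : Summable fun v : {w : V // w ∉ S} => tOf (q v.1)
  /-- OUTPUT of N31e/N31f first sentence (ll. 588–609): Rallis' inner product formula for the chosen `φ`,
  `⟨θ_φ(χ'), θ_φ(χ')⟩ = c · vol([U(W_i)]) · ∏_v I_v(φ_v)` (J.-S. Li 1992 Thm 2.1, (26)–(27); Weil 1965 Thm 5) -/
  rallis : RCLike.re ⟪theta, theta⟫_ℂ = c * vol * ∏' v, I v

namespace LocalFactorDatum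

variable {E : Type*} [NormedAddCommGroup E] [InnerProductSpace ℂ E] (D : LocalFactorDatum V E)

/-- `a_v := χ'_v(ϖ_v) ν_v(ϖ_v)`. -/
def a (v : V) : ℂ := D.chiPi v * D.nuPi v

/-- (Ported verbatim from the HodgeCMPerL package; no docstring in the source.) -/
theorem a_norm (v : V) (hv : v ∉ D.S) : ‖D.a v‖ = 1 := norm_mul_eq_one (D.chi_norm v hv) (D.nu_norm v hv)

/-- (Ported verbatim from the HodgeCMPerL package; no docstring in the source.) -/
theorem tailHyps : TailHyps D.S D.I D.q D.a D.IsSplit where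
  two_le_q := D.two_le_q
  a_norm := D.a_norm
  split_val := D.split_val
  nonsplit_val := D.nonsplit_val

/-- **N31h (i), convergence**: `∏_v I_v(φ_v)` converges (to `eulerValue`) … -/
theorem hasProd : HasProd D.I (eulerValue D.S D.I) := hasProd_eulerValue D.tailHyps D.summable_t

/-- … ABSOLUTELY (`Σ_v |I_v − 1| < ∞` and `Σ_v |log I_v| < ∞`) … -/
theorem summable_abs_sub_one : Summable fun v => |D.I v - 1| :=
  EulerProduct.summable_abs_sub_one D.tailHyps D.summable_t

/-- (Ported verbatim from the HodgeCMPerL package; no docstring in the source.) -/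
theorem summable_abs_log : Summable fun v => |Real.log (D.I v)| :=
  EulerProduct.summable_abs_log D.tailHyps D.summable_t

/-- … to a POSITIVE number. -/
theorem tprod_pos : 0 < ∏' v, D.I v := EulerProduct.tprod_pos D.tailHyps D.ram_pos D.summable_t

/-- **N31h (i), positivity**: `⟨θ_φ(χ'), θ_φ(χ')⟩ > 0` (l. 631–632). -/
theorem inner_self_pos : 0 < RCLike.re ⟪D.theta, D.theta⟫_ℂ := by
  rw [D.rallis]
  exact mul_pos (mul_pos D.c_pos D.vol_pos) D.tprod_pos

/-- **N31h (i), non-vanishing**: `θ_φ(χ') ≠ 0` (l. 632). -/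
theorem theta_ne_zero : D.theta ≠ 0 := ne_zero_of_inner_self_pos D.theta D.inner_self_pos

/-- **N31h (i)**: `π_i ≠ 0` — the theta space (span of the lifts, and its closure) is nonzero (l. 632). -/
theorem thetaSpace_ne_bot : Submodule.span ℂ D.Theta ≠ ⊥ := span_ne_bot_of_mem D.theta_mem D.theta_ne_zero

/-- (Ported verbatim from the HodgeCMPerL package; no docstring in the source.) -/
theorem thetaSpace_closure_ne_bot : (Submodule.span ℂ D.Theta).topologicalClosure ≠ ⊥ :=
  closure_span_ne_bot_of_mem D.theta_mem D.theta_ne_zero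

open scoped Classical in
/-- **Bridge to the prior interface**: the datum yields a `Perl34.C4.RallisDatum` (with `tail := exp Σ log`,
`innerSelf := re⟪θ,θ⟫`, `c := c · vol`), all of whose formerly posited convergence / bound fields are now PROVED. -/
def toRallisDatum : Perl34.C4.RallisDatum V where
  Iloc := D.I
  S := D.S
  tpar v := if v ∈ D.S then 0 else tOf (D.q v)
  apar v := if v ∈ D.S then 1 else D.a v
  IsSplit := D.IsSplit
  c := D.c * D.vol
  c_pos := mul_pos D.c_pos D.vol_pos
  innerSelf := RCLike.re ⟪D.theta, D.theta⟫_ℂ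
  tail := Real.exp (∑' v : {w : V // w ∉ D.S}, Real.log (D.I v.1))
  AX7_factor := by
    rw [D.rallis, EulerProduct.tprod_eq_eulerValue D.tailHyps D.summable_t, eulerValue]
    ring
  AX7_tail := tail_hasProd D.tailHyps D.summable_t
  tpar_nonneg v := by
    by_cases hv : v ∈ D.S
    · simp [hv]
    · simp only [hv, if_false]; exact tOf_nonneg (D.q v)
  tpar_le v := by
    by_cases hv : v ∈ D.S
    · simp [hv]
    · simp only [hv, if_false]; exact tOf_le_half (D.two_le_q v hv)
  apar_norm v := by
    by_cases hv : v ∈ D.S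
    · simp [hv]
    · simp only [hv, if_false]; exact D.a_norm v hv
  A11_summable := D.summable_t.congr fun v => by simp only [v.2, if_false]
  AX7_split_val v hv hs := by
    simp only [hv, if_false]
    exact D.split_val v hv hs
  AX7_nonsplit_val := D.nonsplit_val
  ram_pos := D.ram_pos

end LocalFactorDatum

/-! ### Plugging into the carver's second layer `N31_split` (a `Perl34.C4.CharsDischarge` per torus side)

The carver (Carver/PerL34/Chars.lean, 03:27Z) types N31h as the fields `RallisDatum.AX7_tail` +
`CharsDischarge.innerSelf_eq` + `CharsDischarge.allowed_of_theta`.  Of these, `AX7_tail` and `innerSelf_eq` are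
DISCHARGED below (theorems), and `allowed_of_theta` — "θ_φ(χ') ≠ 0 ⇒ (W_i,μ_i,χ'_i) allowed", i.e. the
CONSTITUENT HALF (ii) of ll. 632–635 read through Def 3.2 — is the ONE residual hypothesis `hallowed`. -/

section CharsDischargeAdapter

open Perl34

variable {H HG CG G SK SigIdx SigIdxG : Type*}
variable [NormedAddCommGroup H] [InnerProductSpace ℂ H] [CompleteSpace H]
variable [NormedAddCommGroup HG] [InnerProductSpace ℂ HG] [CompleteSpace HG]
variable [NormedAddCommGroup CG] [NormedSpace ℂ CG]
variable [Group G] [TopologicalSpace G] [TopologicalSpace SK]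
variable {C : IsolationCore H HG CG G SK SigIdx SigIdxG}

/-- **N31h (ii), the CONSTITUENT HALF — typed RESIDUAL, NOT proved here** (PerL v5 ll. 632–635: "`π_i` is
generated by the `θ(φ,χ'_i)` with `φ_b` in the isotypic parts singled out in (a), which realise `J⁺` at `ι₁` and
`𝟏` at `b ≠ ι₁` as `(𝔤_b,K_b)`-modules [Y1neg, Lemmas 3.1, 3.2]; so every irreducible constituent of the closure
of `π_i` has archimedean component `J⁺ ⊗ 𝟏^{⊗}`, i.e. lies in `𝒜^{1,0}`"), in the only vocabulary the package has
for it today — the prior interface's `TorusData.allowed` (Def 3.2 read for the constructed data): for every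
character `χ` of the torus side, a NONZERO theta lift makes `χ` allowed.  `[Y1neg]` is internal and NOT citable
(LEMMAS.md §0); print re-sourcing and the missing `(𝔤,K)`-module vocabulary (LEMMAS.md §3 D2/D4/D5) are recorded
in HOME/GAPS.md, entry N31h(ii). -/
def ConstituentHalf (D : TorusData C) (L : D.X → LocalFactorDatum V HG) : Prop :=
  ∀ χ : D.X, (L χ).theta ≠ 0 → D.allowed χ

/-- **N31h ⇒ the `CharsDischarge` package of one torus side**, from one local-factor datum per character
(the outputs of N31d/e/f/g for the `φ` chosen for that character) and the constituent half (residual (ii)).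
`AX7_tail` is the theorem `tail_hasProd`; `innerSelf_eq` holds because `re⟪θ,θ⟫ = ‖θ‖²`. -/
def charsDischargeOf (D : TorusData C) (L : D.X → LocalFactorDatum V HG) (hii : ConstituentHalf D L) :
    C4.CharsDischarge D V where
  rallis χ := (L χ).toRallisDatum
  θvec χ := (L χ).theta
  innerSelf_eq χ := by
    show RCLike.re ⟪(L χ).theta, (L χ).theta⟫_ℂ = ‖(L χ).theta‖ ^ 2
    exact inner_self_eq_norm_sq _
  allowed_of_theta := hii

/-- **HONEST SPLIT of N31h**: analytic half (i) — PROVED for every character (`LocalFactorDatum.theta_ne_zero`,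
`analyticHalf`) — and constituent half (ii) — residual — give, through the kernel-checked prior skeleton
`CharsDischarge.H_chars`, the conclusion of Lemma 4.2(b) for the torus side: every character is allowed.
CONDITIONAL only on (ii) and on the upstream-node fields of the data `L χ`. -/
theorem allowed_of_localFactorData (D : TorusData C) (L : D.X → LocalFactorDatum V HG)
    (hii : ConstituentHalf D L) : ∀ χ : D.X, D.allowed χ :=
  (charsDischargeOf D L hii).H_chars

/-- The residual (ii) is USED non-vacuously: its premise `θ ≠ 0` is a THEOREM for every character (half (i)). -/
theorem theta_ne_zero_all (D : TorusData C) (L : D.X → LocalFactorDatum V HG) (χ : D.X) :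
    (L χ).theta ≠ 0 :=
  (L χ).theta_ne_zero

end CharsDischargeAdapter

/-! ### The node statement and the honest split -/

/-- **N31h (i), analytic half** as ONE proposition over the datum (typed by this seat VERBATIM from tex ll. 631–632,
pending the carver's `N31h_statement`): the product converges absolutely to a positive number, the self inner
product of the lift is positive, the lift and the theta space are nonzero. -/
def AnalyticHalf {E : Type*} [NormedAddCommGroup E] [InnerProductSpace ℂ E] (D : LocalFactorDatum V E) : Prop :=
  (Summable fun v => |D.I v - 1|) ∧ (∃ P : ℝ, 0 < P ∧ HasProd D.I P) ∧
    0 < RCLike.re (inner ℂ D.theta D.theta) ∧ D.theta ≠ 0 ∧ Submodule.span ℂ D.Theta ≠ ⊥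

/-- **PROOF of the analytic half.** -/
theorem analyticHalf {E : Type*} [NormedAddCommGroup E] [InnerProductSpace ℂ E] (D : LocalFactorDatum V E) :
    AnalyticHalf D :=
  ⟨D.summable_abs_sub_one, ⟨eulerValue D.S D.I, eulerValue_pos D.ram_pos, D.hasProd⟩,
    D.inner_self_pos, D.theta_ne_zero, D.thetaSpace_ne_bot⟩

end EulerProduct

end PerL34

end HodgeCM

end
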